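import Literature.AnabelianGeometry.SemiGraphs.TemperedCompletionOpenSubgroups
import HarnessLib

/-!
# Profinite completions RESTRICT to open subgroups of finite index ("closure = completion")
# (classical lemmas over the interface `IsProfiniteCompletion` of [SemiAnbd] §6)

Mochizuki, *Semi-graphs of anabelioids*, Publ. RIMS **42** (2006) [SemiAnbd], §6 p. 69 ("the `∧` denotes
profinite completion, or, equivalently, closure in `Π_{X_K}`") and the proof of Lemma 6.3 (ii) p. 70
("replacing `F` by an open subgroup of `F` of finite index") [cite: MochizukiSemiAnbd2006, §6 p.69].

PROOF-ONLY companion (abc-iut cell, prover abc-iut-L2-d1 gen 4) of `TemperedAnabelian.lean`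
(`IsProfiniteCompletion`, abc-iut-L3-t2) and `TemperedCompletionOpenSubgroups.lean` (abc-iut-w5-d139);
sequel of this seat's `TemperedCompletionExistence.lean` (existence/uniqueness/injectivity).  No
definition, no named fact.

* `IsProfiniteCompletion.exists_restrict_of_isOpen_of_finiteIndex` — **"closure = completion" for open
  subgroups of finite index**: if `ι : F → F̂` is a profinite completion and `U ≤ F` is open of finite
  index, then the restriction `ι|_U : U → (ι(U))⁻` (the closure of `ι(U)` in `F̂`) is a profinite
  completion of `U`.  This is the fact every "replace `X` by the finite étale covering `X̲̲`" step uses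
  (e.g. `Π^tp_{X̲̲} = C.Huu ⊆ Π^tp_X` in the [EtTh] §2 model: `Π_{X̲̲} = (Π^tp_{X̲̲})^∧ =` the closure of
  `Π^tp_{X̲̲}` in `Π_X`).
* `IsProfiniteCompletion.index_topologicalClosure_map_eq` — **the index is preserved**:
  `[F̂ : (ι U)⁻] = [F : U]` (the map induced by `ι` on cosets is injective because `(ι U)⁻` pulls back
  to `U`, surjective because `ι(F)` is dense and the cosets of the open subgroup `(ι U)⁻` are open).
* `IsProfiniteCompletion.normal_subgroupOf_topologicalClosure_map` — **closures preserve normality**: for ANY continuous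
  homomorphism `ι : F → F̂` of topological groups and `H ⊴ K ≤ F`, the closure `(ι H)⁻` is normal in the
  closure `(ι K)⁻` (conjugation is continuous; the normaliser condition is closed and contains `ι(K)`).
  E.g. `Π_{X̲̲} ⊴ Π_{X̲}` inside `Π_X` from `Π^tp_{X̲̲} ⊴ Π^tp_{X̲}` ([EtTh] §2).
HONEST FRAMING: classical topological group theory; nothing of [SemiAnbd] is asserted beyond the
definition; no side is taken on [IUTchIII] Cor. 3.12.
-/

noncomputable section

namespace Literature.AnabelianGeometry.SemiGraphs

namespace IsProfiniteCompletion

open Topology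

universe u v w

variable {F : Type u} {Fhat : Type v} [Group F] [TopologicalSpace F] [IsTopologicalGroup F]
  [Group Fhat] [TopologicalSpace Fhat] [IsTopologicalGroup Fhat] {ι : F →ₜ* Fhat}

/-! ### Restriction to open subgroups of finite index -/

/-- **The profinite completion restricts to open subgroups of finite index** ("replacing `F` by an open
subgroup of finite index", [SemiAnbd] proof of Lem. 6.3 (ii) p. 70; "closure = completion", §6 p. 69):
for `ι : F → F̂` a profinite completion and `U ≤ F` open of finite index, the restriction of `ι` to `U`,
valued in the closure `(ι U)⁻ ≤ F̂`, is a profinite completion of `U`.  (Open normal subgroups of finite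
index of `U` are open of finite index in `F`; their `ι`-closures are open in `F̂`, pull back to
themselves (`comap_topologicalClosure_map`), and are normalised by `(ι U)⁻` by continuity.)
[cite: MochizukiSemiAnbd2006, §6 p.69] -/
theorem exists_restrict_of_isOpen_of_finiteIndex (hι : IsProfiniteCompletion ι) (U : Subgroup F)
    (hU : IsOpen (U : Set F)) [U.FiniteIndex] :
    ∃ ιU : U →ₜ* (U.map ι.toMonoidHom).topologicalClosure,
      (∀ u : U, ((ιU u : (U.map ι.toMonoidHom).topologicalClosure) : Fhat) = ι u) ∧
      IsProfiniteCompletion ιU := by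
  haveI := hι.compactSpace; haveI := hι.t2Space; haveI := hι.totallyDisconnectedSpace
  set W : Subgroup Fhat := (U.map ι.toMonoidHom).topologicalClosure with hWdef
  have hWclosed : IsClosed (W : Set Fhat) := Subgroup.isClosed_topologicalClosure _
  haveI : CompactSpace W := isCompact_iff_compactSpace.mp hWclosed.isCompact
  let ιU : U →ₜ* W :=
    { toMonoidHom := (ι.toMonoidHom.comp U.subtype).codRestrict W fun u =>
        Subgroup.le_topologicalClosure _ ⟨u, u.2, rfl⟩
      continuous_toFun := (ι.continuous.comp continuous_subtype_val).subtype_mk _ }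
  have hιU : ∀ u : U, ((ιU u : W) : Fhat) = ι u := fun u => rfl
  refine ⟨ιU, hιU, inferInstance, inferInstance, inferInstance, ?_, ?_, ?_⟩
  · -- dense range: `ι(U)` is dense in its closure
    intro x
    rw [IsEmbedding.subtypeVal.closure_eq_preimage_closure_image, Set.mem_preimage]
    have himg : Subtype.val '' Set.range ιU = ι '' (U : Set F) := by
      ext y
      constructor
      · rintro ⟨_, ⟨u, rfl⟩, rfl⟩; exact ⟨u, u.2, rfl⟩
      · rintro ⟨u, hu, rfl⟩; exact ⟨ιU ⟨u, hu⟩, ⟨⟨u, hu⟩, rfl⟩, rfl⟩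
    rw [himg]
    have hx : (x : Fhat) ∈ ((U.map ι.toMonoidHom).topologicalClosure : Set Fhat) := x.2
    rwa [Subgroup.topologicalClosure_coe, Subgroup.coe_map] at hx
  · -- open normal finite-index subgroups of `U` are pulled back from `W`
    intro N hN
    -- `N` as a subgroup of `F`: open, of finite index
    let N' : Subgroup F := N.toSubgroup.map U.subtype
    have hN'U : N' ≤ U := fun x ⟨n, _, hn⟩ => hn ▸ n.2
    have hN'open : IsOpen (N' : Set F) := by
      have : (N' : Set F) = Subtype.val '' (N.toSubgroup : Set U) := rfl
      rw [this]
      exact hU.isOpenEmbedding_subtypeVal.isOpenMap _ N.isOpen'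
    haveI hN'fi : N'.FiniteIndex := by
      haveI := hN
      refine ⟨?_⟩
      change (N.toSubgroup.map U.subtype).index ≠ 0
      rw [Subgroup.index_map_subtype]
      exact mul_ne_zero Subgroup.FiniteIndex.index_ne_zero Subgroup.FiniteIndex.index_ne_zero
    -- its closure `V₀` in `F̂`: open, pulls back to `N'`
    set V₀ : Subgroup Fhat := (N'.map ι.toMonoidHom).topologicalClosure with hV₀def
    have hV₀open : IsOpen (V₀ : Set Fhat) := isOpen_topologicalClosure_map hι N' hN'open
    have hV₀comap : V₀.comap ι.toMonoidHom = N' := comap_topologicalClosure_map hι N' hN'open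
    have hV₀W : V₀ ≤ W := Subgroup.topologicalClosure_mono (Subgroup.map_mono hN'U)
    -- `V₀` is normalised by `W` (by `ι(U)`, then by density/closedness)
    have hnorm : ∀ w ∈ W, ∀ v ∈ V₀, w * v * w⁻¹ ∈ V₀ := by
      -- the set of `w` normalising `V₀` into itself is closed and contains `ι(U)`
      have hS : IsClosed {w : Fhat | ∀ v ∈ V₀, w * v * w⁻¹ ∈ V₀} := by
        have : {w : Fhat | ∀ v ∈ V₀, w * v * w⁻¹ ∈ V₀} = ⋂ v ∈ V₀, (fun w => w * v * w⁻¹) ⁻¹' (V₀ : Set Fhat) := by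
          ext w; simp
        rw [this]
        refine isClosed_biInter fun v _ => ?_
        exact (Subgroup.isClosed_of_isOpen _ hV₀open).preimage (by fun_prop)
      have hsub : ι '' (U : Set F) ⊆ {w : Fhat | ∀ v ∈ V₀, w * v * w⁻¹ ∈ V₀} := by
        rintro _ ⟨u, hu, rfl⟩ v hv
        -- conjugation by `ι u` maps `ι N'` into itself (`N ⊴ U`), hence its closure into itself
        have hf : Continuous fun x : Fhat => ι u * x * (ι u)⁻¹ := by fun_prop
        have hv' : v ∈ closure (ι '' (N' : Set F)) := by
          rw [hV₀def, ← SetLike.mem_coe, Subgroup.topologicalClosure_coe, Subgroup.coe_map] at hv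
          exact hv
        have h1 : ι u * v * (ι u)⁻¹ ∈ closure ((fun x : Fhat => ι u * x * (ι u)⁻¹) '' (ι '' (N' : Set F))) :=
          image_closure_subset_closure_image hf ⟨v, hv', rfl⟩
        have h2 : (fun x : Fhat => ι u * x * (ι u)⁻¹) '' (ι '' (N' : Set F)) ⊆ ι '' (N' : Set F) := by
          rintro _ ⟨_, ⟨n, hn, rfl⟩, rfl⟩
          obtain ⟨m, hm, rfl⟩ := hn
          refine ⟨u * (m : F) * u⁻¹, ⟨⟨u, hu⟩ * m * ⟨u, hu⟩⁻¹, N.isNormal'.conj_mem m hm ⟨u, hu⟩, rfl⟩, ?_⟩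
          simp only [map_mul, map_inv, Subgroup.coe_subtype]
        have h3 := closure_mono h2 h1
        rw [hV₀def, ← SetLike.mem_coe, Subgroup.topologicalClosure_coe, Subgroup.coe_map]
        exact h3
      intro w hw
      have hw' : w ∈ closure (ι '' (U : Set F)) := by
        rw [hWdef, ← SetLike.mem_coe, Subgroup.topologicalClosure_coe, Subgroup.coe_map] at hw; exact hw
      exact closure_minimal hsub hS hw'
    haveI hVn : (V₀.subgroupOf W).Normal :=
      ⟨fun v hv w => by
        rw [Subgroup.mem_subgroupOf] at hv ⊢
        exact hnorm w w.2 v hv⟩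
    have hVopen : IsOpen ((V₀.subgroupOf W : Subgroup W) : Set W) := hV₀open.preimage continuous_subtype_val
    refine ⟨{ toSubgroup := V₀.subgroupOf W, isOpen' := hVopen, isNormal' := hVn }, ?_⟩
    ext n
    change n ∈ N.toSubgroup ↔ ιU n ∈ V₀.subgroupOf W
    rw [Subgroup.mem_subgroupOf, hιU]
    change _ ↔ (n : F) ∈ V₀.comap ι.toMonoidHom
    rw [hV₀comap]
    constructor
    · intro hn; exact ⟨n, hn, rfl⟩
    · rintro ⟨m, hm, hmn⟩
      have : m = n := Subtype.ext hmn
      exact this ▸ hm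
  · intro V
    exact V.isOpen'.preimage ιU.continuous

/-! ### The index is preserved -/

/-- **The closure of `ι(U)` has the same index as `U`** ("closure = completion", [SemiAnbd] §6 p. 69):
for `ι : F → F̂` a profinite completion and `U ≤ F` open of finite index, `[F̂ : (ι U)⁻] = [F : U]` — the
map induced by `ι` on left cosets `F/U → F̂/(ι U)⁻` is injective because `(ι U)⁻` pulls back to `U`
(`comap_topologicalClosure_map`) and surjective because `ι(F)` is dense and the cosets of the open
subgroup `(ι U)⁻` are open.  (E.g. `[Π_X : Π_{X̲̲}] = [Π^tp_X : Π^tp_{X̲̲}]`; for `U` of index `2` the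
closure `(ι U)⁻` is an open subgroup of index `2`.) [cite: MochizukiSemiAnbd2006, §6 p.69] -/
theorem index_topologicalClosure_map_eq (hι : IsProfiniteCompletion ι) (U : Subgroup F)
    (hU : IsOpen (U : Set F)) [U.FiniteIndex] :
    (U.map ι.toMonoidHom).topologicalClosure.index = U.index := by
  set W : Subgroup Fhat := (U.map ι.toMonoidHom).topologicalClosure with hWdef
  have hWU : W.comap ι.toMonoidHom = U := comap_topologicalClosure_map hι U hU
  have hWopen : IsOpen (W : Set Fhat) := isOpen_topologicalClosure_map hι U hU
  have hmem : ∀ a b : F, (ι a)⁻¹ * ι b ∈ W ↔ a⁻¹ * b ∈ U := fun a b => by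
    rw [← hWU, Subgroup.mem_comap, map_mul, map_inv]
    rfl
  -- the map induced by `ι` on left cosets
  let f : F ⧸ U → Fhat ⧸ W := Quotient.map' ι fun a b h =>
    QuotientGroup.leftRel_apply.mpr ((hmem a b).mpr (QuotientGroup.leftRel_apply.mp h))
  have hf : ∀ a : F, f (QuotientGroup.mk a) = QuotientGroup.mk (ι a) := fun a => rfl
  have hinj : Function.Injective f := by
    intro x y hxy
    induction x using QuotientGroup.induction_on with
    | H a =>
      induction y using QuotientGroup.induction_on with
      | H b =>
        rw [hf, hf, QuotientGroup.eq] at hxy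
        exact QuotientGroup.eq.mpr ((hmem a b).mp hxy)
  have hsurj : Function.Surjective f := by
    intro z
    induction z using QuotientGroup.induction_on with
    | H x =>
      -- the open coset `x (ι U)⁻` meets the dense image of `ι`
      obtain ⟨a, ha⟩ := hι.denseRange.exists_mem_open (hWopen.leftCoset x)
        ⟨x, (mem_leftCoset_iff x).mpr (by rw [inv_mul_cancel]; exact W.one_mem)⟩
      refine ⟨QuotientGroup.mk a, ?_⟩
      rw [hf, QuotientGroup.eq]
      have h1 : x⁻¹ * ι a ∈ W := (mem_leftCoset_iff x).mp ha
      have h2 := W.inv_mem h1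
      rwa [mul_inv_rev, inv_inv] at h2
  rw [Subgroup.index_eq_card, Subgroup.index_eq_card]
  exact (Nat.card_congr (Equiv.ofBijective f ⟨hinj, hsurj⟩)).symm

/-! ### Closures preserve normality (any continuous homomorphism) -/

omit [IsTopologicalGroup F] in
/-- **Closures preserve normality** ("closure = completion", [SemiAnbd] §6 p. 69, applied to a normal
pair): for any continuous homomorphism `ι : F → F̂` of topological groups and subgroups `H ≤ K ≤ F` with
`H` normal in `K`, the closure `(ι H)⁻` is normal in the closure `(ι K)⁻`.  (Conjugation by `ι k`,
`k ∈ K`, maps `ι(H)` into itself, hence its closure into itself; the set of `w ∈ F̂` conjugating `(ι H)⁻`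
into itself is closed, so it contains `(ι K)⁻`.)  No completion, compactness or index hypothesis.
E.g. `Π^tp_{X̲̲} ⊴ Π^tp_{X̲}` gives `Π_{X̲̲} ⊴ Π_{X̲}` for the closures in `Π_X` ([EtTh] §2).
[cite: MochizukiSemiAnbd2006, §6 p.69] -/
theorem normal_subgroupOf_topologicalClosure_map (ι : F →ₜ* Fhat) {H K : Subgroup F} (hHK : H ≤ K)
    (hN : (H.subgroupOf K).Normal) :
    (((H.map ι.toMonoidHom).topologicalClosure).subgroupOf
      (K.map ι.toMonoidHom).topologicalClosure).Normal := by
  set V : Subgroup Fhat := (H.map ι.toMonoidHom).topologicalClosure with hVdef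
  set W : Subgroup Fhat := (K.map ι.toMonoidHom).topologicalClosure with hWdef
  have hVclosed : IsClosed (V : Set Fhat) := Subgroup.isClosed_topologicalClosure _
  -- the set of `w` conjugating `V` into itself is closed and contains `ι(K)`
  have hS : IsClosed {w : Fhat | ∀ v ∈ V, w * v * w⁻¹ ∈ V} := by
    have : {w : Fhat | ∀ v ∈ V, w * v * w⁻¹ ∈ V} =
        ⋂ v ∈ V, (fun w => w * v * w⁻¹) ⁻¹' (V : Set Fhat) := by
      ext w; simp
    rw [this]
    refine isClosed_biInter fun v _ => ?_
    exact hVclosed.preimage (by fun_prop)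
  have hsub : ι '' (K : Set F) ⊆ {w : Fhat | ∀ v ∈ V, w * v * w⁻¹ ∈ V} := by
    rintro _ ⟨k, hk, rfl⟩ v hv
    have hf : Continuous fun x : Fhat => ι k * x * (ι k)⁻¹ := by fun_prop
    have hv' : v ∈ closure (ι '' (H : Set F)) := by
      rw [hVdef, ← SetLike.mem_coe, Subgroup.topologicalClosure_coe, Subgroup.coe_map] at hv
      exact hv
    have h1 : ι k * v * (ι k)⁻¹ ∈
        closure ((fun x : Fhat => ι k * x * (ι k)⁻¹) '' (ι '' (H : Set F))) :=
      image_closure_subset_closure_image hf ⟨v, hv', rfl⟩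
    have h2 : (fun x : Fhat => ι k * x * (ι k)⁻¹) '' (ι '' (H : Set F)) ⊆ ι '' (H : Set F) := by
      rintro _ ⟨_, ⟨h, hh, rfl⟩, rfl⟩
      refine ⟨k * h * k⁻¹, ?_, by simp only [map_mul, map_inv]⟩
      have := hN.conj_mem ⟨h, hHK hh⟩ (Subgroup.mem_subgroupOf.mpr hh) ⟨k, hk⟩
      exact Subgroup.mem_subgroupOf.mp this
    have h3 := closure_mono h2 h1
    rw [hVdef, ← SetLike.mem_coe, Subgroup.topologicalClosure_coe, Subgroup.coe_map]
    exact h3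
  have hnorm : ∀ w ∈ W, ∀ v ∈ V, w * v * w⁻¹ ∈ V := by
    intro w hw
    have hw' : w ∈ closure (ι '' (K : Set F)) := by
      rw [hWdef, ← SetLike.mem_coe, Subgroup.topologicalClosure_coe, Subgroup.coe_map] at hw; exact hw
    exact closure_minimal hsub hS hw'
  exact ⟨fun v hv w => by
    rw [Subgroup.mem_subgroupOf] at hv ⊢
    exact hnorm w w.2 v hv⟩

end IsProfiniteCompletion

end Literature.AnabelianGeometry.SemiGraphs

end
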